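import Summits.QuantumAdvantage.AdviceFreeQNC0.ProductClassExtension
import Summits.QuantumAdvantage.AdviceFreeQNC0.CellParitySteps
import HarnessLib

/-!
# Cell qa-qnc0 (rung F-Q1, route RingFrame, crux α `RingToElim`): the CROSS-CELL obstruction —
# Steps 1–2 for a doubly-even low-degree cell family

Second form of the cell parity obstruction (`CellParityObstruction.lean`), needed for windows
whose interior selectors READ their own half (`CrossFreeWindow.lean`).  Data on `w = x ++ z`
(`x ∈ {0,1}^L`, `z ∈ {0,1}^M`, `i = |x|`, `j = |z|` mod 3, `ρ = i + j`, `σ = 2i + j`): a CELL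
FAMILY `Θ_ij` of Boolean functions of `𝔽₂`-degree `≤ D` on `{0,1}^{L+M}` (in the application:
everything whose walk character is constant on cells — the outside triple, the window ends, a
conditioned middle block — however its selectors read the window), ARBITRARY triples `A_r` on
`{0,1}^L`, `B_r` on `{0,1}^M`, and the win bit `W(x ++ z) = Θ_ij(w) ⊕ A_ρ(x) ⊕ B_σ(z)`
(the section hypothesis `hW`).  Assuming the failure set has `≤ ε·2^{L+M}` points:

* `crossCell_row_approx` / `crossCell_col_approx` — slices: `A_ρ ≈ α` on the class `i`,
  `B_σ ≈ β` on the class `j`, with `α, β` of degree `≤ D`;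
* `crossCell_globalise` — the identity `Θ_ij = ¬(α(x) ⊕ β(z))` holds off `γ·2^{L+M}` points of
  the whole cube (two-dimensional robust Hegedűs, passed as a hypothesis).

The theorem (rows and columns, no anti-diagonals): `CrossCellObstruction.lean`.  The cell's
statements (prover qn-prover-3, 2026-08-27); not in print.  WHAT THIS IS NOT: no walk strategies
here; no separation.
-/

noncomputable section

namespace Summit.QuantumAdvantage.AdviceFreeQNC0

open Finset
open Literature.Computability.MetaComplexity Literature.Computability.MetaComplexity.Smolensky

variable {L M D : ℕ}

/-- From `T ⊕ a ⊕ b = 1`, the bit `a` is `¬(T ⊕ b)`. -/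
theorem xor3_solve (T a b : Bool) (h : xor T (xor a b) = true) : a = !(xor T b) := by
  revert h; cases T <;> cases a <;> cases b <;> decide

section Setting

variable {Θ : ℕ → ℕ → (Fin (L + M) → Bool) → Bool} {A : ℕ → (Fin L → Bool) → Bool}
  {B : ℕ → (Fin M → Bool) → Bool} {W : (Fin (L + M) → Bool) → Bool}

/- The CROSS-CELL FORMULA of the win bit `W`, in block coordinates, is the section hypothesis `hW`. -/
variable (hW : ∀ (x : Fin L → Bool) (z : Fin M → Bool), W (Fin.append x z) =
    xor (Θ (wt x % 3) (wt z % 3) (Fin.append x z))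
      (xor (A ((wt x + wt z) % 3) x) (B ((2 * wt x + wt z) % 3) z)))
include hW

/-- **Step 1 (rows).**  If the failure set has `≤ ε·2^{L+M}` points, then for every cell `(i, j)`
there is a degree-`≤ D` function `α` agreeing with `A_ρ` on the class `i` up to `4ε·2^L` points. -/
theorem crossCell_row_approx (hΘ : ∀ i j, HasDeg (Θ i j) D) (hM : 3 ≤ M)
    {ε : ℝ} (hfail : ((univ.filter fun w : Fin (L + M) → Bool => W w = false).card : ℝ) ≤
      ε * (2 : ℝ) ^ (L + M)) (i j : ℕ) :
    ∃ α : (Fin L → Bool) → Bool, HasDeg α D ∧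
      ((univ.filter fun x : Fin L → Bool =>
        wt x % 3 = i % 3 ∧ A ((i + j) % 3) x ≠ α x).card : ℝ) ≤ 4 * ε * (2 : ℝ) ^ L := by
  obtain ⟨z₀, hz₀, hrow⟩ := exists_row_le (L := L) hM (fun w => W w = false) hfail j
  refine ⟨fun x => !(xor (Θ (i % 3) (j % 3) (Fin.append x z₀)) (B ((2 * i + j) % 3) z₀)),
    ?_, le_trans ?_ hrow⟩
  · exact hasDeg_not (hasDeg_xor (hasDeg_append_left z₀ (hΘ _ _)) (hasDeg_const _ D))
  · refine card_filter_mono_real _ _ fun x hx => ?_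
    obtain ⟨hxi, hne⟩ := hx
    by_contra hwin
    have hwin' : W (Fin.append x z₀) = true := by
      cases hW' : W (Fin.append x z₀)
      · exact absurd hW' hwin
      · rfl
    rw [hW x z₀, hxi, hz₀, (cell_residues hxi hz₀).1, (cell_residues hxi hz₀).2] at hwin'
    exact hne (xor3_solve _ _ _ hwin')

/-- **Step 1 (columns).**  Symmetrically, a degree-`≤ D` function `β` agreeing with `B_σ` on the
class `j` up to `4ε·2^M` points. -/
theorem crossCell_col_approx (hΘ : ∀ i j, HasDeg (Θ i j) D) (hL : 3 ≤ L)
    {ε : ℝ} (hfail : ((univ.filter fun w : Fin (L + M) → Bool => W w = false).card : ℝ) ≤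
      ε * (2 : ℝ) ^ (L + M)) (i j : ℕ) :
    ∃ β : (Fin M → Bool) → Bool, HasDeg β D ∧
      ((univ.filter fun z : Fin M → Bool =>
        wt z % 3 = j % 3 ∧ B ((2 * i + j) % 3) z ≠ β z).card : ℝ) ≤ 4 * ε * (2 : ℝ) ^ M := by
  obtain ⟨x₀, hx₀, hcol⟩ := exists_col_le (M := M) hL (fun w => W w = false) hfail i
  refine ⟨fun z => !(xor (Θ (i % 3) (j % 3) (Fin.append x₀ z)) (A ((i + j) % 3) x₀)),
    ?_, le_trans ?_ hcol⟩
  · exact hasDeg_not (hasDeg_xor (hasDeg_append_right x₀ (hΘ _ _)) (hasDeg_const _ D))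
  · refine card_filter_mono_real _ _ fun z hz => ?_
    obtain ⟨hzj, hne⟩ := hz
    by_contra hwin
    have hwin' : W (Fin.append x₀ z) = true := by
      cases hW' : W (Fin.append x₀ z)
      · exact absurd hW' hwin
      · rfl
    rw [hW x₀ z, hx₀, hzj, (cell_residues hx₀ hzj).1, (cell_residues hx₀ hzj).2] at hwin'
    have := xor3_solve (Θ (i % 3) (j % 3) (Fin.append x₀ z)) (B ((2 * i + j) % 3) z)
      (A ((i + j) % 3) x₀) (by
        revert hwin'
        cases Θ (i % 3) (j % 3) (Fin.append x₀ z) <;>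
          cases B ((2 * i + j) % 3) z <;> cases A ((i + j) % 3) x₀ <;> decide)
    exact hne this

/-- **Step 2 (globalisation).**  With `α, β` as in Step 1 for the cell `(i, j)`, the degree-`≤ D`
identity `Θ_ij(w) = ¬(α(x) ⊕ β(z))` holds on the cell off `9ε·2^{L+M}` points, hence — by the
two-dimensional robust Hegedűs lemma, supplied as the hypothesis `hT` — off `γ·2^{L+M}` points of
the whole cube. -/
theorem crossCell_globalise (hΘ : ∀ i j, HasDeg (Θ i j) D)
    {ε γ εT : ℝ} (h9 : 9 * ε ≤ εT)
    (hT : ∀ i j : ℕ, ∀ R : (Fin (L + M) → Bool) → Bool, HasDeg R D →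
      ((univ.filter fun w : Fin (L + M) → Bool => R w = true ∧
        wt (fun i : Fin L => w (Fin.castAdd M i)) % 3 = i % 3 ∧
        wt (fun j : Fin M => w (Fin.natAdd L j)) % 3 = j % 3).card : ℝ) ≤ εT * (2 : ℝ) ^ (L + M) →
      ((univ.filter fun w : Fin (L + M) → Bool => R w = true).card : ℝ) ≤ γ * (2 : ℝ) ^ (L + M))
    (hfail : ((univ.filter fun w : Fin (L + M) → Bool => W w = false).card : ℝ) ≤
      ε * (2 : ℝ) ^ (L + M))
    (i j : ℕ) {α : (Fin L → Bool) → Bool} {β : (Fin M → Bool) → Bool} (hα : HasDeg α D)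
    (hβ : HasDeg β D)
    (hαA : ((univ.filter fun x : Fin L → Bool =>
      wt x % 3 = i % 3 ∧ A ((i + j) % 3) x ≠ α x).card : ℝ) ≤ 4 * ε * (2 : ℝ) ^ L)
    (hβB : ((univ.filter fun z : Fin M → Bool =>
      wt z % 3 = j % 3 ∧ B ((2 * i + j) % 3) z ≠ β z).card : ℝ) ≤ 4 * ε * (2 : ℝ) ^ M) :
    ((univ.filter fun w : Fin (L + M) → Bool =>
      Θ (i % 3) (j % 3) w ≠
        !(xor (α (fun i : Fin L => w (Fin.castAdd M i))) (β (fun j : Fin M => w (Fin.natAdd L j))))).card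
        : ℝ) ≤ γ * (2 : ℝ) ^ (L + M) := by
  set R : (Fin (L + M) → Bool) → Bool := fun w => !(xor (Θ (i % 3) (j % 3) w)
      (xor (α (fun i : Fin L => w (Fin.castAdd M i))) (β (fun j : Fin M => w (Fin.natAdd L j)))))
    with hR
  have hRdeg : HasDeg R D :=
    hasDeg_not (hasDeg_xor (hΘ _ _) (hasDeg_xor (hasDeg_leftBlock hα) (hasDeg_rightBlock hβ)))
  -- the identity fails exactly where `R = true`
  have heq : (univ.filter fun w : Fin (L + M) → Bool =>
      Θ (i % 3) (j % 3) w ≠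
        !(xor (α (fun i : Fin L => w (Fin.castAdd M i))) (β (fun j : Fin M => w (Fin.natAdd L j))))) =
      univ.filter fun w => R w = true := by
    refine Finset.filter_congr fun w _ => ?_
    simp only [hR]
    cases Θ (i % 3) (j % 3) w <;>
      cases α (fun i : Fin L => w (Fin.castAdd M i)) <;>
        cases β (fun j : Fin M => w (Fin.natAdd L j)) <;> simp
  rw [heq]
  refine hT i j R hRdeg (le_trans ?_ (mul_le_mul_of_nonneg_right h9 (by positivity)))
  -- on the cell, `R = true` only at failures, bad rows or bad columns
  have hsub : ∀ w : Fin (L + M) → Bool, (R w = true ∧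
      wt (fun i : Fin L => w (Fin.castAdd M i)) % 3 = i % 3 ∧
      wt (fun j : Fin M => w (Fin.natAdd L j)) % 3 = j % 3) →
      (W w = false ∨
        ((wt (fun i : Fin L => w (Fin.castAdd M i)) % 3 = i % 3 ∧
          A ((i + j) % 3) (fun i : Fin L => w (Fin.castAdd M i)) ≠
            α (fun i : Fin L => w (Fin.castAdd M i))) ∨
        (wt (fun j : Fin M => w (Fin.natAdd L j)) % 3 = j % 3 ∧
          B ((2 * i + j) % 3) (fun j : Fin M => w (Fin.natAdd L j)) ≠
            β (fun j : Fin M => w (Fin.natAdd L j))))) := by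
    intro w ⟨hRw, hxi, hzj⟩
    by_contra hcon
    push Not at hcon
    obtain ⟨hWw, hAα, hBβ⟩ := hcon
    have hWt : W w = true := by
      cases h' : W w
      · exact absurd h' hWw
      · rfl
    have hform := hW (fun i : Fin L => w (Fin.castAdd M i)) (fun j : Fin M => w (Fin.natAdd L j))
    rw [Fin.append_castAdd_natAdd] at hform
    rw [hform, hxi, hzj, (cell_residues hxi hzj).1, (cell_residues hxi hzj).2, hAα hxi, hBβ hzj]
      at hWt
    simp only [hR] at hRw
    revert hRw hWt
    cases Θ (i % 3) (j % 3) w <;>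
      cases α (fun i : Fin L => w (Fin.castAdd M i)) <;>
        cases β (fun j : Fin M => w (Fin.natAdd L j)) <;> simp
  have h1 := card_filter_mono_real _ _ hsub
  -- union bound for the three alternatives
  have hU : ((univ.filter fun w : Fin (L + M) → Bool => W w = false ∨
      ((wt (fun i : Fin L => w (Fin.castAdd M i)) % 3 = i % 3 ∧
          A ((i + j) % 3) (fun i : Fin L => w (Fin.castAdd M i)) ≠
            α (fun i : Fin L => w (Fin.castAdd M i))) ∨
        (wt (fun j : Fin M => w (Fin.natAdd L j)) % 3 = j % 3 ∧
          B ((2 * i + j) % 3) (fun j : Fin M => w (Fin.natAdd L j)) ≠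
            β (fun j : Fin M => w (Fin.natAdd L j))))).card : ℝ) ≤
      ((univ.filter fun w : Fin (L + M) → Bool => W w = false).card : ℝ) +
      ((univ.filter fun w : Fin (L + M) → Bool =>
        wt (fun i : Fin L => w (Fin.castAdd M i)) % 3 = i % 3 ∧
          A ((i + j) % 3) (fun i : Fin L => w (Fin.castAdd M i)) ≠
            α (fun i : Fin L => w (Fin.castAdd M i))).card : ℝ) +
      ((univ.filter fun w : Fin (L + M) → Bool =>
        wt (fun j : Fin M => w (Fin.natAdd L j)) % 3 = j % 3 ∧
          B ((2 * i + j) % 3) (fun j : Fin M => w (Fin.natAdd L j)) ≠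
            β (fun j : Fin M => w (Fin.natAdd L j))).card : ℝ) := by
    have ha := card_filter_or_le_real (fun w : Fin (L + M) → Bool => W w = false)
      (fun w : Fin (L + M) → Bool =>
        ((wt (fun i : Fin L => w (Fin.castAdd M i)) % 3 = i % 3 ∧
          A ((i + j) % 3) (fun i : Fin L => w (Fin.castAdd M i)) ≠
            α (fun i : Fin L => w (Fin.castAdd M i))) ∨
        (wt (fun j : Fin M => w (Fin.natAdd L j)) % 3 = j % 3 ∧
          B ((2 * i + j) % 3) (fun j : Fin M => w (Fin.natAdd L j)) ≠
            β (fun j : Fin M => w (Fin.natAdd L j)))))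
    have hb := card_filter_or_le_real
      (fun w : Fin (L + M) → Bool =>
        wt (fun i : Fin L => w (Fin.castAdd M i)) % 3 = i % 3 ∧
          A ((i + j) % 3) (fun i : Fin L => w (Fin.castAdd M i)) ≠
            α (fun i : Fin L => w (Fin.castAdd M i)))
      (fun w : Fin (L + M) → Bool =>
        wt (fun j : Fin M => w (Fin.natAdd L j)) % 3 = j % 3 ∧
          B ((2 * i + j) % 3) (fun j : Fin M => w (Fin.natAdd L j)) ≠
            β (fun j : Fin M => w (Fin.natAdd L j)))
    linarith
  -- the two product counts
  have hA' : ((univ.filter fun w : Fin (L + M) → Bool =>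
      wt (fun i : Fin L => w (Fin.castAdd M i)) % 3 = i % 3 ∧
        A ((i + j) % 3) (fun i : Fin L => w (Fin.castAdd M i)) ≠
          α (fun i : Fin L => w (Fin.castAdd M i))).card : ℝ) ≤ 4 * ε * (2 : ℝ) ^ (L + M) := by
    rw [card_filter_leftBlock (fun x : Fin L → Bool => wt x % 3 = i % 3 ∧ A ((i + j) % 3) x ≠ α x)]
    push_cast
    rw [pow_add]
    nlinarith [pow_pos (show (0:ℝ) < 2 by norm_num) M]
  have hB' : ((univ.filter fun w : Fin (L + M) → Bool =>
      wt (fun j : Fin M => w (Fin.natAdd L j)) % 3 = j % 3 ∧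
        B ((2 * i + j) % 3) (fun j : Fin M => w (Fin.natAdd L j)) ≠
          β (fun j : Fin M => w (Fin.natAdd L j))).card : ℝ) ≤ 4 * ε * (2 : ℝ) ^ (L + M) := by
    rw [card_filter_rightBlock (fun z : Fin M → Bool => wt z % 3 = j % 3 ∧ B ((2 * i + j) % 3) z ≠ β z)]
    push_cast
    rw [pow_add]
    nlinarith [pow_pos (show (0:ℝ) < 2 by norm_num) L]
  linarith

end Setting

end Summit.QuantumAdvantage.AdviceFreeQNC0
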